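import Literature.MathematicalPhysics.QuantumFieldTheory.PinnedOneLinkLaplaceMorse
import Literature.MathematicalPhysics.QuantumFieldTheory.PinnedOneLinkLaplaceIntegrals
import Literature.Analysis.Calculus.ClosedSubgroupExpChart
import HarnessLib

/-!
# Proof of `OneLinkLaplaceConcentration` (Laplace concentration of strongly pinned one-link laws)

Final file of the proof of the named fact
`Literature.MathematicalPhysics.QuantumFieldTheory.OneLinkLaplaceConcentration`
(`PinnedOneLinkLaplace.lean`), discharged here as `OneLinkLaplaceConcentration_holds`.

For a compact group `G` with a faithful continuous unitary representation `ρ = r.ρ`, the law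
`ν ∝ exp(s Re tr ρ(h⁻¹g) + β W(g)) dσ(g)` (`σ` Haar probability, `W` a combination of at most `32`
variable words of length four with weights `|wₘ| ≤ 1`) satisfies `Var_ν(ψ) ≤ K₁ M²/s` for every
bounded measurable `ψ` with `|ψ a - ψ b| ≤ M ‖ρ a - ρ b‖_F`, uniformly in `β ≥ 0`, `s ≥ c₀(1+β)`,
`h` and the words. The argument ("Lie-light Laplace method"):

1. `F = -Re tr ρ(h⁻¹ ·) - (β/s) W` is continuous on the compact `G`; let `g₀` minimise it, so
   `ν ∝ e^{-s(F - F(g₀))} σ`, and `Var_ν(ψ) ≤ ∫ (ψ - ψ g₀)² dν ≤ M² ∫ d² dν`,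
   `d(g) = ‖ρ g - ρ g₀‖_F` (`integral_sub_average_sq_le`).
2. Re-centred at `g₀` (`X = ρ(g₀⁻¹ g) ∈ H = ρ(G)`, `d(g) = ‖X - 1‖_F`), `F` becomes
   `Φ(X) = -Re tr(A X) - ε W̃(X)` minimal over `H` at `1`; the exponential chart of the compact
   matrix group `H` (`Literature.Analysis.Calculus.exists_exp_chart_range`, von Neumann 1929) and
   `PinnedOneLinkLaplaceMorse.morse_bounds` give `a d² ≤ F - F(g₀) ≤ 2 d²` with `a, ε₀` depending
   on `G, r` only, for `ε = β/s ≤ ε₀` — which is where the threshold `s ≥ c₀(1 + β)`,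
   `c₀ = 1/ε₀`, comes from.
3. Volume doubling of `σ` for Hilbert–Schmidt balls and convexity in `s`
   (`PinnedOneLinkLaplaceIntegrals.integral_sq_mul_exp_neg_le_of_two_sided`) turn the two-sided
   bounds into `∫ d² dν ≤ K/s`.

No chart is used for Haar measure and no asymptotic expansion is performed: compared with the
printed Laplace method (Breitung, LNM 1592, Ch. 5, Thm. 41/44) the conclusion is only the
second-moment bound `O(1/s)` (not the asymptotics), which is what the lattice application
(`StrongPinningPoincare` of route `FradkinShenkerFlow`, `YangMills`) consumes.
-/

noncomputable section

open MeasureTheory Set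
open scoped Matrix.Norms.Frobenius Matrix
open Matrix NormedSpace

namespace Literature.MathematicalPhysics.QuantumFieldTheory

section Variance

variable {S : Type*} [MeasurableSpace S]

/-- **The mean minimises centred second moments**: `∫ (ψ - ∫ψ)² dν ≤ ∫ (ψ - c)² dν` for a
probability measure and bounded measurable `ψ`. [folklore] -/
theorem integral_sub_average_sq_le (ν : Measure S) [IsProbabilityMeasure ν] {ψ : S → ℝ}
    (hψ : Measurable ψ) {C : ℝ} (hC : ∀ x, |ψ x| ≤ C) (c : ℝ) :
    ∫ x, (ψ x - ∫ y, ψ y ∂ν) ^ 2 ∂ν ≤ ∫ x, (ψ x - c) ^ 2 ∂ν := by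
  set m := ∫ y, ψ y ∂ν with hm
  have hψi : Integrable ψ ν := integrable_of_measurable_of_abs_le hψ hC
  have h1 : Integrable (fun x => ψ x - m) ν := hψi.sub (integrable_const m)
  have h2 : Integrable (fun x => (ψ x - m) ^ 2) ν := by
    refine integrable_of_measurable_of_abs_le ((hψ.sub_const m).pow_const 2) (C := (C + |m|) ^ 2)
      fun x => ?_
    rw [abs_pow]
    refine pow_le_pow_left₀ (abs_nonneg _) ?_ 2
    calc |ψ x - m| ≤ |ψ x| + |m| := abs_sub _ _
      _ ≤ C + |m| := add_le_add (hC x) le_rfl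
  have hpt : (fun x => (ψ x - c) ^ 2) =
      fun x => (ψ x - m) ^ 2 + (2 * (m - c)) * (ψ x - m) + (m - c) ^ 2 := by
    funext x; ring
  have h3 : Integrable (fun x => 2 * (m - c) * (ψ x - m)) ν := h1.const_mul _
  have h4 : Integrable (fun x => (ψ x - m) ^ 2 + 2 * (m - c) * (ψ x - m)) ν := h2.add h3
  have hint : ∫ x, (ψ x - c) ^ 2 ∂ν = ∫ x, (ψ x - m) ^ 2 ∂ν + (m - c) ^ 2 := by
    rw [hpt, integral_add h4 (integrable_const _), integral_add h2 h3,
      integral_const_mul, integral_sub hψi (integrable_const m), integral_const, integral_const]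
    simp [hm]
  rw [hint]
  nlinarith [sq_nonneg (m - c)]

end Variance

section Main

variable {G : Type} [Group G] [TopologicalSpace G] [IsTopologicalGroup G] [CompactSpace G]
  [MeasurableSpace G] [BorelSpace G]

/-- Continuous real functions on the compact group are integrable for the Haar probability.
[folklore] -/
private theorem integrable_of_continuous' {f : G → ℝ} (hf : Continuous f) : Integrable f (haarProbability G) :=
  integrableOn_univ.1 (hf.continuousOn.integrableOn_compact' isCompact_univ MeasurableSet.univ)

omit [IsTopologicalGroup G] [CompactSpace G] [MeasurableSpace G] [BorelSpace G] in
/-- The letters `g ↦ ρ((v k).getD g)` of a lattice word are continuous. [folklore] -/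
theorem continuous_letter (r : LatticeRep G) (o : Option G) :
    Continuous fun g => r.ρ (o.getD g) := by
  cases o with
  | none => simpa using r.continuous
  | some u => simpa using continuous_const

/-- **Laplace concentration of strongly pinned one-link laws** — the named fact
`OneLinkLaplaceConcentration` holds (see the module docstring for the proof: the second-moment
form of the multivariate Laplace method at a non-degenerate interior maximum, here obtained from
the group structure, the exponential chart of the compact matrix group and volume doubling).
[cite: Breitung1994, Ch. 5 Thm. 41 and Thm. 44] -/
theorem OneLinkLaplaceConcentration_holds : OneLinkLaplaceConcentration := by
  intro G _ _ _ _ _ _ _ r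
  -- the representation
  have hρc : Continuous r.ρ := r.continuous
  have hρu : ∀ g, r.ρ g ∈ Matrix.unitaryGroup (Fin r.N) ℂ := r.mem_unitary
  -- (1) exponential chart of `H = ρ(G)`
  obtain ⟨r₀, hr₀, hchart₀⟩ := Literature.Analysis.Calculus.exists_exp_chart_range r.ρ hρc
  set rr : ℝ := min r₀ (1 / 2) with hrr
  have hrr0 : 0 < rr := lt_min hr₀ (by norm_num)
  have hrr2 : rr ≤ 1 / 2 := min_le_right _ _
  have hchart : ∀ X ∈ Set.range r.ρ, ‖X - 1‖ < rr → ∃ Y : Matrix (Fin r.N) (Fin r.N) ℂ,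
      (∀ t : ℝ, exp (t • Y) ∈ Set.range r.ρ) ∧ exp Y = X ∧ ‖Y‖ ≤ 2 * ‖X - 1‖ := by
    rintro _ ⟨g, rfl⟩ hg
    obtain ⟨Y, hY, hYg, hYn⟩ := hchart₀ g (hg.trans_le (min_le_left _ _))
    exact ⟨Y, fun t => by obtain ⟨k, hk⟩ := hY t; exact ⟨k, hk⟩, hYg, hYn⟩
  -- (2) constants
  obtain ⟨c₁, c₂, hc₁, hc₂, hword⟩ := exists_word_taylor r.N
  set Ñ : ℝ := (r.N : ℝ) + 1 with hÑ
  set ε₀ : ℝ := rr ^ 4 / (10 ^ 8 * Ñ ^ 2 * (32 * c₁ + 32 * c₂ + 64 * r.N + 1)) with hε₀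
  have hε₀0 : 0 < ε₀ := by positivity
  set a : ℝ := rr ^ 2 / (16 * Ñ) with ha
  have ha0 : 0 < a := by positivity
  obtain ⟨k, hk⟩ := pow_unbounded_of_one_lt (2 / a) (by norm_num : (1 : ℝ) < 4)
  have hk' : 2 ≤ 4 ^ k * a := by
    rw [div_lt_iff₀ ha0] at hk; exact hk.le
  set D : ℝ := 5 ^ (2 * r.N ^ 2) with hD
  set Kf : ℝ := 4 * D ^ (k + 1) / (3 * a) with hKf
  have hKf0 : 0 < Kf := by positivity
  refine ⟨1 / ε₀, Kf, by positivity, hKf0, ?_⟩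
  intro β hβ s hs h Λ _ w v hw hT ψ M hψm hψb hM hlip
  obtain ⟨Cψ, hCψ⟩ := hψb
  -- `s > 0` and `ε = β/s ≤ ε₀`
  have hs1 : 1 / ε₀ ≤ s := by
    have : 1 / ε₀ * 1 ≤ 1 / ε₀ * (1 + β) := mul_le_mul_of_nonneg_left (by linarith) (by positivity)
    linarith
  have hs0 : 0 < s := lt_of_lt_of_le (by positivity) hs1
  set ε : ℝ := β / s with hεdef
  have hε : 0 ≤ ε := div_nonneg hβ hs0.le
  have hεle : ε ≤ ε₀ := by
    rw [hεdef, div_le_iff₀ hs0]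
    have h1 : 1 / ε₀ * (1 + β) ≤ s := hs
    rw [div_mul_eq_mul_div, one_mul, div_le_iff₀ hε₀0] at h1
    nlinarith
  -- the exponent `F` and its minimiser `g₀`
  set F : G → ℝ := fun g => -(r.ρ (h⁻¹ * g)).trace.re -
      ε * ∑ m, w m * (r.ρ ((v m 0).getD g) * r.ρ ((v m 1).getD g) *
        (r.ρ ((v m 2).getD g))ᴴ * (r.ρ ((v m 3).getD g))ᴴ).trace.re with hF
  have hFc : Continuous F := by
    refine ((Complex.continuous_re.comp ((hρc.comp (continuous_const.mul continuous_id)).matrix_trace)).neg).sub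
      (continuous_const.mul (continuous_finsetSum _ fun m _ => continuous_const.mul
        (Complex.continuous_re.comp ?_)))
    exact ((((continuous_letter r (v m 0)).mul (continuous_letter r (v m 1))).mul
      (continuous_letter r (v m 2)).matrix_conjTranspose).mul
      (continuous_letter r (v m 3)).matrix_conjTranspose).matrix_trace
  obtain ⟨g₀, -, hg₀⟩ := isCompact_univ.exists_isMinOn univ_nonempty hFc.continuousOn
  have hmin : ∀ g, F g₀ ≤ F g := fun g => hg₀ (mem_univ g)
  -- matrix-side data, re-centred at `g₀`
  set A : Matrix (Fin r.N) (Fin r.N) ℂ := r.ρ (h⁻¹ * g₀) with hA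
  set B : Matrix (Fin r.N) (Fin r.N) ℂ := r.ρ g₀ with hB
  set p : Λ → Fin 4 → Option (Matrix (Fin r.N) (Fin r.N) ℂ) := fun m k => (v m k).map r.ρ with hp
  have hpU : ∀ m k C, p m k = some C → C ∈ Matrix.unitaryGroup (Fin r.N) ℂ := by
    intro m k C hC
    simp only [hp, Option.map_eq_some_iff] at hC
    obtain ⟨u, -, rfl⟩ := hC
    exact hρu u
  have hpT : ∀ T : Finset Λ, (∀ m ∈ T, ∃ k, p m k = none) → T.card ≤ 32 := by
    intro T hT'
    refine hT T fun m hm => ?_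
    obtain ⟨k, hk⟩ := hT' m hm
    exact ⟨k, by simpa [hp] using hk⟩
  set W : Matrix (Fin r.N) (Fin r.N) ℂ → ℝ := fun X => ∑ m, w m *
      ((p m 0).elim (B * X) (fun C => C) * (p m 1).elim (B * X) (fun C => C) *
        ((p m 2).elim (B * X) (fun C => C))ᴴ * ((p m 3).elim (B * X) (fun C => C))ᴴ).trace.re with hW
  set Φ : Matrix (Fin r.N) (Fin r.N) ℂ → ℝ := fun X => -(A * X).trace.re - ε * W X with hΦ
  have hletter : ∀ m k g, (p m k).elim (B * r.ρ (g₀⁻¹ * g)) (fun C => C) = r.ρ ((v m k).getD g) := by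
    intro m k g
    simp only [hp, hB]
    cases v m k with
    | none => simp [← map_mul]
    | some u => simp
  have hAX : ∀ g, A * r.ρ (g₀⁻¹ * g) = r.ρ (h⁻¹ * g) := by
    intro g; rw [hA, ← map_mul, mul_assoc, mul_inv_cancel_left]
  have hlink : ∀ g, F g = Φ (r.ρ (g₀⁻¹ * g)) := by
    intro g
    simp only [hF, hΦ, hW, hletter, hAX]
  have hlink1 : F g₀ = Φ 1 := by rw [hlink g₀, inv_mul_cancel, map_one]
  -- hypotheses of the Morse bounds
  have hHU : ∀ X ∈ Set.range r.ρ, X ∈ Matrix.unitaryGroup (Fin r.N) ℂ := by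
    rintro _ ⟨g, rfl⟩; exact hρu g
  have hstar : ∀ X ∈ Set.range r.ρ, Xᴴ ∈ Set.range r.ρ := by
    rintro _ ⟨g, rfl⟩; exact ⟨g⁻¹, map_inv_eq_conjTranspose r.ρ hρu g⟩
  obtain ⟨DW, hDW1, hDW2⟩ := exists_perturbation_taylor (N := r.N) hc₁ hc₂ w hw p hpU hpT
    (fun p' hp' => hword B (hρu g₀) p' hp')
  have hW2 : ∀ X ∈ Matrix.unitaryGroup (Fin r.N) ℂ, |W X - W 1 - DW (X - 1)| ≤ 32 * c₂ * ‖X - 1‖ ^ 2 :=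
    fun X hX => hDW2 X (norm_of_mem_unitaryGroup hX).le
  have hW3 : ∀ X ∈ Matrix.unitaryGroup (Fin r.N) ℂ, ∀ X' ∈ Matrix.unitaryGroup (Fin r.N) ℂ,
      |W X - W X'| ≤ 64 * r.N := fun X hX X' hX' =>
    abs_perturbation_sub_le (hρu g₀) w hw p hpU hpT hX hX'
  have hminH : ∀ X ∈ Set.range r.ρ, Φ 1 ≤ Φ X := by
    rintro _ ⟨g, rfl⟩
    rw [← hlink1]
    have := hmin (g₀ * g)
    rwa [hlink (g₀ * g), inv_mul_cancel_left] at this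
  have hmorse : ∀ g, a * frobNorm (r.ρ g - r.ρ g₀) ^ 2 ≤ F g - F g₀ ∧
      F g - F g₀ ≤ 2 * frobNorm (r.ρ g - r.ρ g₀) ^ 2 := by
    intro g
    have hm := morse_bounds (H := Set.range r.ρ) hHU hstar hrr0 hrr2 hchart
      (K₁ := 32 * c₁) (K₂ := 32 * c₂) (K₃ := 64 * r.N) (by positivity) (by positivity) (by positivity)
      hDW1 hW2 hW3 (A := A) ⟨h⁻¹ * g₀, rfl⟩ hε hεle (Φ := Φ)
      (fun X => rfl) hminH (X := r.ρ (g₀⁻¹ * g)) ⟨_, rfl⟩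
    have hn : ‖r.ρ (g₀⁻¹ * g) - 1‖ = frobNorm (r.ρ g - r.ρ g₀) := by
      rw [← frobNorm_eq_norm]
      have : r.ρ (g₀⁻¹ * g) - 1 = r.ρ g₀⁻¹ * (r.ρ g - r.ρ g₀) := by
        rw [mul_sub, ← map_mul, ← map_mul, inv_mul_cancel, map_one]
      rw [this, frobNorm_unitary_mul (hρu _)]
    rw [← hlink, ← hlink1, hn] at hm
    exact hm
  -- the second-moment bound under `e^{-s(F - F g₀)} σ`
  set μ := haarProbability G with hμ
  set Fd : G → ℝ := fun g => F g - F g₀ with hFd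
  have hFdc : Continuous Fd := hFc.sub continuous_const
  have hmom := integral_sq_mul_exp_neg_le_of_two_sided r.ρ hρc hρu g₀ hFdc ha0 hs0 hk'
    (fun g => (hmorse g).1) (fun g => (hmorse g).2)
  have hZi : Integrable (fun g => Real.exp (-s * Fd g)) μ :=
    integrable_of_continuous' (Real.continuous_exp.comp (continuous_const.mul hFdc))
  have hZpos : 0 < ∫ g, Real.exp (-s * Fd g) ∂μ := integral_exp_pos hZi
  -- the tilted measure
  have hEF : ∀ g, s * (r.ρ (h⁻¹ * g)).trace.re + β * ∑ m, w m *
      (r.ρ ((v m 0).getD g) * r.ρ ((v m 1).getD g) * (r.ρ ((v m 2).getD g))ᴴ *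
        (r.ρ ((v m 3).getD g))ᴴ).trace.re = -s * F g₀ + -s * Fd g := by
    intro g
    have hsne : s ≠ 0 := hs0.ne'
    simp only [hFd, hF, hεdef]
    field_simp
    ring
  have hEc : Continuous fun g => s * (r.ρ (h⁻¹ * g)).trace.re + β * ∑ m, w m *
      (r.ρ ((v m 0).getD g) * r.ρ ((v m 1).getD g) * (r.ρ ((v m 2).getD g))ᴴ *
        (r.ρ ((v m 3).getD g))ᴴ).trace.re := by
    simp_rw [hEF]; exact continuous_const.add (continuous_const.mul hFdc)
  have hexpi : Integrable (fun g => Real.exp (s * (r.ρ (h⁻¹ * g)).trace.re + β * ∑ m, w m *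
      (r.ρ ((v m 0).getD g) * r.ρ ((v m 1).getD g) * (r.ρ ((v m 2).getD g))ᴴ *
        (r.ρ ((v m 3).getD g))ᴴ).trace.re)) μ :=
    integrable_of_continuous' (Real.continuous_exp.comp hEc)
  haveI hν : IsProbabilityMeasure (μ.tilted fun g => s * (r.ρ (h⁻¹ * g)).trace.re + β * ∑ m, w m *
      (r.ρ ((v m 0).getD g) * r.ρ ((v m 1).getD g) * (r.ρ ((v m 2).getD g))ᴴ *
        (r.ρ ((v m 3).getD g))ᴴ).trace.re) := isProbabilityMeasure_tilted hexpi
  set ν := μ.tilted fun g => s * (r.ρ (h⁻¹ * g)).trace.re + β * ∑ m, w m *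
      (r.ρ ((v m 0).getD g) * r.ρ ((v m 1).getD g) * (r.ρ ((v m 2).getD g))ᴴ *
        (r.ρ ((v m 3).getD g))ᴴ).trace.re with hν'
  -- Step A: variance ≤ centred second moment ≤ M² ∫ d²
  have hA1 : ∫ g, (ψ g - ∫ g', ψ g' ∂ν) ^ 2 ∂ν ≤ ∫ g, (ψ g - ψ g₀) ^ 2 ∂ν :=
    integral_sub_average_sq_le ν hψm hCψ (ψ g₀)
  have hd2 : ∀ g, frobNorm (r.ρ g - r.ρ g₀) ^ 2 ≤ 4 * r.N := fun g => by
    have h1 := frobNorm_sub_le_of_mem_unitaryGroup (hρu g) (hρu g₀)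
    have h2 := pow_le_pow_left₀ (frobNorm_nonneg _) h1 2
    rw [mul_pow, Real.sq_sqrt (Nat.cast_nonneg _), Fintype.card_fin] at h2
    linarith
  have hdi : Integrable (fun g => M ^ 2 * frobNorm (r.ρ g - r.ρ g₀) ^ 2) ν := by
    refine integrable_of_measurable_of_abs_le
      (measurable_const.mul ((continuous_frobDist r.ρ hρc g₀).measurable.pow_const 2))
      (C := M ^ 2 * (4 * r.N)) fun g => ?_
    rw [abs_of_nonneg (by positivity)]
    exact mul_le_mul_of_nonneg_left (hd2 g) (sq_nonneg _)
  have hA2 : ∫ g, (ψ g - ψ g₀) ^ 2 ∂ν ≤ M ^ 2 * ∫ g, frobNorm (r.ρ g - r.ρ g₀) ^ 2 ∂ν := by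
    rw [← integral_const_mul]
    refine integral_mono_of_nonneg (ae_of_all _ fun g => sq_nonneg _) hdi (ae_of_all _ fun g => ?_)
    have h1 := hlip g g₀
    have h2 : |ψ g - ψ g₀| ^ 2 ≤ (M * frobNorm (r.ρ g - r.ρ g₀)) ^ 2 :=
      pow_le_pow_left₀ (abs_nonneg _) h1 2
    rw [sq_abs] at h2
    calc (ψ g - ψ g₀) ^ 2 ≤ (M * frobNorm (r.ρ g - r.ρ g₀)) ^ 2 := h2
      _ = M ^ 2 * frobNorm (r.ρ g - r.ρ g₀) ^ 2 := by ring
  -- Step B: `∫ d² dν` as a ratio of Haar integrals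
  have hratio : ∫ g, frobNorm (r.ρ g - r.ρ g₀) ^ 2 ∂ν =
      (∫ g, frobNorm (r.ρ g - r.ρ g₀) ^ 2 * Real.exp (-s * Fd g) ∂μ) /
        ∫ g, Real.exp (-s * Fd g) ∂μ := by
    rw [hν', integral_tilted]
    simp_rw [hEF, Real.exp_add, smul_eq_mul]
    rw [integral_const_mul]
    simp_rw [mul_div_mul_left _ _ (Real.exp_pos (-s * F g₀)).ne', div_mul_eq_mul_div]
    rw [integral_div]
    congr 1
    refine integral_congr_ae (ae_of_all _ fun g => ?_)
    ring
  have hC : ∫ g, frobNorm (r.ρ g - r.ρ g₀) ^ 2 ∂ν ≤ Kf / s := by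
    rw [hratio, div_le_iff₀ hZpos]
    refine hmom.trans (le_of_eq ?_)
    rw [hKf, hD, div_div]
  -- conclusion
  calc ∫ g, (ψ g - ∫ g', ψ g' ∂ν) ^ 2 ∂ν ≤ ∫ g, (ψ g - ψ g₀) ^ 2 ∂ν := hA1
    _ ≤ M ^ 2 * ∫ g, frobNorm (r.ρ g - r.ρ g₀) ^ 2 ∂ν := hA2
    _ ≤ M ^ 2 * (Kf / s) := mul_le_mul_of_nonneg_left hC (sq_nonneg _)
    _ = M ^ 2 / (s / Kf) := by rw [div_div_eq_mul_div, mul_div_assoc]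

end Main

end Literature.MathematicalPhysics.QuantumFieldTheory

end
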